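import Summits.QuantumFields.YangMills.Theorems.UnitScaleTiltProp7CornerCombL1Propagation
import Literature.MathematicalPhysics.QuantumFieldTheory.Balaban1983to89.B4Eq19LatticeOperators
import HarnessLib

/-!
# (n3)-COMB (II), row `hMcomb₂`, located difficulty H2-1 — THE `ℓ¹` PROPAGATION THEOREM WITH THE READING CHAINS INSTANTIATED BY CENTRED BOXES
# (the absorbing chain `Z` and the localised chains `U` of `…CornerCombL1Propagation` as `B4Eq19LatticeOperators.box` sets — hypotheses-free geometry)

Crux `stmt-QuantumFields-19200` `MinimiserStabilityRegPr`, route-R E′ (A′)-on-Σ, P-A2 (β); supplier design (II) (★routeR-w1 g9 MASTER 6efb31c3 §4: H2-1); ★px17's H-line (H-4b's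
socket).  Width seat `ym3-torus-px18` (gen 4); `--kind proof --supports stmt-QuantumFields-19200 --as helper`; THEOREMS ONLY; «(O2) groundwork»; count-neutral.  YM₃ on T³ is a ladder
rung (R3), not Clay; nothing here is progress on the YM mass gap.

## The point
`…CornerCombL1Propagation.sum_norm_linTower_le_localised` leaves the absorbing chain `Z` and the reading chains `U i w` as hypotheses.  Here they are INSTANTIATED by the centred boxes of
lit `B4Eq19LatticeOperators` (`box z r = {y : |y_i − z_i| ≤ r}` on `Zd d = Site d`, the letters of ✓p705643's localised-mass row): with the radius sequence `ρ(j, A) := Lʲ·(A + 4) − 4`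
(`L ≥ 2`), `Z m := box (L^{n−m}•c) (ρ(n−m, R))` absorbs the straight segments and both blocks, and `U i w m := box (L^{i+1−m}•w) (ρ(i−m, L))` absorbs below the corner `L•w` with its top
`box (L•w) L ⊇` the tree-word step sites (✓II-2b `mem_steps_treeWord_inBox`).  OUTPUT ★★★ `sum_norm_linTower_le_boxes`: for every centre `c` and radius `R`,
`Σ_{z∈box c R}Σ_κ‖Q n Y z κ‖ ≤ (Π_{m<n}w_m)·Σ_{y ∈ box (Lⁿ•c) (Lⁿ(R+4)−4)}Σ_ν‖Y y ν‖ + d·L·Σ_{i<n}(Π_{m<i}w_m)·Σ_{z∈box c R}Σ_κ(Σ_{x ∈ box (Lⁿ•z) (Lⁱ(L+4)−4)}Σ_μ‖Y x μ‖ + Σ_{x ∈ box (Lⁿ•(z+e κ)) (Lⁱ(L+4)−4)}Σ_μ‖Y x μ‖)`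
— every reading box sits BELOW THE LEVEL-`n` CORNER `Lⁿ•z` with radius `< Lⁱ(L+4)` INDEPENDENT OF `n`: the sockets of ✓p705643 `sum_sq_le_localisedMass` (small box `box (Lⁿ•z) ρ` inside the
period-sized box around the same centre) once the source is tied to two-block `ℓ²` masses (★px17 H-4b ∕ ★routeR-w6's brick §1) — the H2-1(E) member's remaining work is that pricing + cells.
* §1 box arithmetic: `abs_coord_block_le`, ★ `block_mem_box` (`z ∈ box c R ⇒ L•z + r + t•e_κ ∈ box (L•c) (L·R + 2L)`), ★ `shiftBlock_mem_box`, `rad_step` (`L·ρ(j,A) + 2L ≤ ρ(j+1,A)` for `L ≥ 2`),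
  `steps_mem_box_corner` (tree-word steps from `L•w` lie in `box (L•w) L`), `smul_pow_succ'`.
* §2 ★★★ `sum_norm_linTower_le_boxes`.
HONEST: geometry + instantiation; nothing of H2-1's member ∕ `hMcomb₂` ∕ `hMcomb` ∕ (β) ∕ the crux is proved or claimed; rung R3 (YM₃ on T³), NOT d = 4, NOT Clay; YM gap NOT proved.
References: T. Bałaban, CMP 98 (1985) 17–51 [Balaban1985Averaging] ((2) p.17, (42)–(43) pp.23–24, (125) p.36); M. Giaquinta, *Multiple integrals…* [Giaquinta1984] (Ch. III §1 p.64: the boxes).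
-/

set_option autoImplicit false

noncomputable section

open scoped BigOperators
open Finset

namespace Summit.QuantumFields.YangMills.Theorems.Prop7CornerCombL1PropagationBoxes

open NormedSpace
open Literature.MathematicalPhysics.QuantumFieldTheory.Balaban1983to89
open ExpMeanLog (eml)
open B7Prop1Explicit (Site Letter e e_apply seg treeWord boxVec gammaWord Wcx Xavg bavg expUnit U1)
open B7Prop2Explicit (avgIter unitaryUnits)
open B7Prop3GeneralRotated (tsum)
open B4Eq19LatticeOperators (box mem_box box_mono)
open Summit.QuantumFields.YangMills.Theorems.Prop7CornerCombFlatPieces (mem_steps_treeWord_inBox)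
open Summit.QuantumFields.YangMills.Theorems.Prop7CornerCombL1Propagation (sum_norm_linTower_le_localised)

variable {d : ℕ}

/-! ## §1 Box arithmetic on `ℤᵈ` -/

/-- one coordinate of a point of the block at `L•z` relative to `L•c`: `|(L•z + r + t•e_κ)_i − (L•c)_i| ≤ L·|z_i − c_i| + 2L` (`r ∈ [0,L)ᵈ`, `t < L`). [folklore] -/
theorem abs_coord_block_le (L : ℕ) (z c : Site d) (r : Fin d → Fin L) {t : ℕ} (ht : t < L) (κ i : Fin d) :
    |((L : ℤ) • z + boxVec L r + (t : ℤ) • e κ) i - ((L : ℤ) • c) i| ≤ (L : ℤ) * |z i - c i| + 2 * L := by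
  have hr : (0 : ℤ) ≤ ((r i : ℕ) : ℤ) ∧ ((r i : ℕ) : ℤ) < L := ⟨by positivity, by exact_mod_cast (r i).isLt⟩
  have ht' : (0 : ℤ) ≤ (t : ℤ) ∧ (t : ℤ) < L := ⟨by positivity, by exact_mod_cast ht⟩
  have hL0 : (0 : ℤ) ≤ L := by positivity
  simp only [Pi.add_apply, Pi.smul_apply, smul_eq_mul, boxVec, e_apply]
  have key : (L : ℤ) * z i + ((r i : ℕ) : ℤ) + (t : ℤ) * (if i = κ then 1 else 0) - (L : ℤ) * c i
      = (L : ℤ) * (z i - c i) + (((r i : ℕ) : ℤ) + (t : ℤ) * (if i = κ then 1 else 0)) := by ring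
  rw [key]
  have hrest : |((r i : ℕ) : ℤ) + (t : ℤ) * (if i = κ then 1 else 0)| ≤ 2 * L := by
    rw [abs_le]; split_ifs <;> constructor <;> nlinarith
  calc |(L : ℤ) * (z i - c i) + (((r i : ℕ) : ℤ) + (t : ℤ) * (if i = κ then 1 else 0))|
      ≤ |(L : ℤ) * (z i - c i)| + |((r i : ℕ) : ℤ) + (t : ℤ) * (if i = κ then 1 else 0)| := abs_add_le _ _
    _ ≤ (L : ℤ) * |z i - c i| + 2 * L := by rw [abs_mul, abs_of_nonneg hL0]; linarith

/-- ★ **BLOCKS ARE ABSORBED**: `z ∈ box c R` ⇒ `L•z + r + t•e_κ ∈ box (L•c) (L·R + 2L)` (`r ∈ [0,L)ᵈ`, `t < L`). [folklore] [cite: Balaban1985Averaging, (2) p.17] -/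
theorem block_mem_box (L : ℕ) {z c : Site d} {R : ℤ} (hz : z ∈ box c R) (r : Fin d → Fin L) {t : ℕ} (ht : t < L) (κ : Fin d) :
    (L : ℤ) • z + boxVec L r + (t : ℤ) • e κ ∈ box ((L : ℤ) • c) ((L : ℤ) * R + 2 * L) := by
  rw [mem_box] at hz ⊢
  intro i
  have h := abs_coord_block_le L z c r ht κ i
  have hL0 : (0 : ℤ) ≤ L := by positivity
  nlinarith [hz i, abs_nonneg (z i - c i)]

/-- ★ the SHIFTED block: `z ∈ box c R` ⇒ `L•z + L•e_κ + s ∈ box (L•c) (L·R + 2L)` (`s ∈ [0,L)ᵈ`; needs `1 ≤ L`). [folklore] [cite: Balaban1985Averaging, (2) p.17] -/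
theorem shiftBlock_mem_box (L : ℕ) (hL : 1 ≤ L) {z c : Site d} {R : ℤ} (hz : z ∈ box c R) (κ : Fin d) (s : Fin d → Fin L) :
    (L : ℤ) • z + (L : ℤ) • e κ + boxVec L s ∈ box ((L : ℤ) • c) ((L : ℤ) * R + 2 * L) := by
  rw [mem_box] at hz ⊢
  intro i
  have hs : (0 : ℤ) ≤ ((s i : ℕ) : ℤ) ∧ ((s i : ℕ) : ℤ) < L := ⟨by positivity, by exact_mod_cast (s i).isLt⟩
  have hL0 : (0 : ℤ) ≤ L := by positivity
  simp only [Pi.add_apply, Pi.smul_apply, smul_eq_mul, boxVec, e_apply]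
  have key : (L : ℤ) * z i + (L : ℤ) * (if i = κ then 1 else 0) + ((s i : ℕ) : ℤ) - (L : ℤ) * c i
      = (L : ℤ) * (z i - c i) + ((L : ℤ) * (if i = κ then 1 else 0) + ((s i : ℕ) : ℤ)) := by ring
  rw [key]
  have hrest : |(L : ℤ) * (if i = κ then 1 else 0) + ((s i : ℕ) : ℤ)| ≤ 2 * L := by
    rw [abs_le]; split_ifs <;> constructor <;> nlinarith
  calc |(L : ℤ) * (z i - c i) + ((L : ℤ) * (if i = κ then 1 else 0) + ((s i : ℕ) : ℤ))|
      ≤ |(L : ℤ) * (z i - c i)| + |(L : ℤ) * (if i = κ then 1 else 0) + ((s i : ℕ) : ℤ)| := abs_add_le _ _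
    _ ≤ (L : ℤ) * R + 2 * L := by
        rw [abs_mul, abs_of_nonneg hL0]
        nlinarith [hz i, abs_nonneg (z i - c i)]

/-- the RADIUS SEQUENCE `ρ(j, A) := Lʲ·(A + 4) − 4` absorbs one step: `L·ρ(j, A) + 2L ≤ ρ(j+1, A)` for `L ≥ 2`. [folklore] -/
theorem rad_step (L : ℕ) (hL : 2 ≤ L) (A : ℤ) (j : ℕ) :
    (L : ℤ) * ((L : ℤ) ^ j * (A + 4) - 4) + 2 * L ≤ (L : ℤ) ^ (j + 1) * (A + 4) - 4 := by
  have hL2 : (2 : ℤ) ≤ L := by exact_mod_cast hL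
  rw [pow_succ]
  nlinarith

/-- `L • (Lʲ • w) = L^{j+1} • w` on `ℤᵈ`. [folklore] -/
theorem smul_pow_smul (L : ℕ) (j : ℕ) (w : Site d) : (L : ℤ) • (((L : ℤ) ^ j) • w) = ((L : ℤ) ^ (j + 1)) • w := by
  rw [smul_smul, pow_succ, mul_comm]

/-- the tree-word step sites from the corner `q` lie in `box q L` (✓II-2b `mem_steps_treeWord_inBox`: `q_i ≤ s_i ≤ q_i + L − 1`). [cite: Balaban1985Averaging, (14) p.19] -/
theorem steps_mem_box_corner (L : ℕ) (q : Site d) (r : Fin d → Fin L) {s : Site d × Letter d}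
    (hs : s ∈ List.zip (List.scanl (fun (z : Site d) (l' : Letter d) => z + l'.vec) q (treeWord (boxVec L r))) (treeWord (boxVec L r))) :
    s.1 ∈ box q (L : ℤ) := by
  rw [mem_box]
  intro i
  have h := mem_steps_treeWord_inBox L r q hs i
  rw [abs_le]; constructor <;> linarith [h.1, h.2]

/-! ## §2 The propagation theorem with boxes -/

variable {𝔸 : Type*} [CStarAlgebra 𝔸] [Nontrivial 𝔸]

/-- ★★★ **THE `ℓ¹` PROPAGATION THEOREM WITH THE READING CHAINS INSTANTIATED BY CENTRED BOXES** (`2 ≤ L`): under the hypotheses of ✓`sum_norm_linTower_le_localised` on the background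
tower and the recursion of `Q`, for every centre `c : ℤᵈ` and radius `R`, with `w_m := L·L⁻ᵈ + 2d·(210·α_m·((2d+2)·L))`,
`Σ_{z∈box c R}Σ_κ‖Q n Y z κ‖ ≤ (Π_{m<n}w_m)·Σ_{y ∈ box (Lⁿ•c) (Lⁿ·(R+4) − 4)}Σ_ν‖Y y ν‖ + d·L·Σ_{i<n}(Π_{m<i}w_m)·Σ_{z∈box c R}Σ_κ(Σ_{x ∈ box (Lⁿ•z) (Lⁱ·(L+4) − 4)}Σ_μ‖Y x μ‖ + Σ_{x ∈ box (Lⁿ•(z + e κ)) (Lⁱ·(L+4) − 4)}Σ_μ‖Y x μ‖)`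
— the reading boxes sit below the level-`n` corners `Lⁿ•z`, `Lⁿ•(z+e_κ)` with radii `< Lⁱ(L+4)` independent of `n`. «(O2) groundwork.» [cite: Balaban1985Averaging, (42)–(43) pp.23–24, (125) p.36] -/
theorem sum_norm_linTower_le_boxes (L : ℕ) (hL : 2 ≤ L) (U₀ : Site d → Fin d → 𝔸ˣ) (n : ℕ)
    (hV : ∀ k, k ≤ n → ∀ (x : Site d) (μ : Fin d), avgIter L U₀ k x μ ∈ unitaryUnits 𝔸)
    (α : ℕ → ℝ) (hα0 : ∀ k, 0 ≤ α k)
    (hα : ∀ k, k < n → ∀ (z : Site d) (κ : Fin d) (r : Fin d → Fin L),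
      ‖((Wcx L (avgIter L U₀ k) ((L : ℤ) • z) κ (boxVec L r) : 𝔸ˣ) : 𝔸) - 1‖ ≤ α k)
    (hα24 : ∀ k, k < n → α k ≤ 1 / 24)
    (Y : Site d → Fin d → 𝔸) (Q : ℕ → (Site d → Fin d → 𝔸) → Site d → Fin d → 𝔸) (hQ0 : Q 0 Y = Y)
    (hQs : ∀ (k : ℕ) (z : Site d) (κ : Fin d), Q (k + 1) Y z κ
      = fderiv ℂ (eml : ((Fin d → Fin L) → 𝔸) → 𝔸) (fun r => ((Wcx L (avgIter L U₀ k) ((L : ℤ) • z) κ (boxVec L r) : 𝔸ˣ) : 𝔸))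
            (fun r => tsum (avgIter L U₀ k) (Q k Y) ((L : ℤ) • z) (gammaWord L κ (boxVec L r) ++ seg κ (-(L : ℤ)))
              * ((Wcx L (avgIter L U₀ k) ((L : ℤ) • z) κ (boxVec L r) : 𝔸ˣ) : 𝔸))
            * (((expUnit (Xavg L (avgIter L U₀ k) ((L : ℤ) • z) κ))⁻¹ : 𝔸ˣ) : 𝔸)
          + ((expUnit (Xavg L (avgIter L U₀ k) ((L : ℤ) • z) κ) : 𝔸ˣ) : 𝔸) * tsum (avgIter L U₀ k) (Q k Y) ((L : ℤ) • z) (seg κ (L : ℤ))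
            * (((expUnit (Xavg L (avgIter L U₀ k) ((L : ℤ) • z) κ))⁻¹ : 𝔸ˣ) : 𝔸))
    (c : Site d) (R : ℤ) :
    ∑ z ∈ box c R, ∑ κ : Fin d, ‖Q n Y z κ‖ ≤
      (∏ m ∈ Finset.range n, ((L : ℝ) * ((L : ℝ) ^ d)⁻¹ + 2 * d * (210 * α m * ((2 * d + 2) * L)))) *
          ∑ y ∈ box (((L : ℤ) ^ n) • c) ((L : ℤ) ^ n * (R + 4) - 4), ∑ ν : Fin d, ‖Y y ν‖ +
        d * L * ∑ i ∈ Finset.range n, (∏ m ∈ Finset.range i, ((L : ℝ) * ((L : ℝ) ^ d)⁻¹ + 2 * d * (210 * α m * ((2 * d + 2) * L)))) *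
          ∑ z ∈ box c R, ∑ κ : Fin d,
            (∑ x ∈ box (((L : ℤ) ^ n) • z) ((L : ℤ) ^ i * (L + 4) - 4), ∑ μ : Fin d, ‖Y x μ‖ +
              ∑ x ∈ box (((L : ℤ) ^ n) • (z + e κ)) ((L : ℤ) ^ i * (L + 4) - 4), ∑ μ : Fin d, ‖Y x μ‖) := by
  have hL1 : 1 ≤ L := le_trans (by norm_num) hL
  -- the absorbing chain `Z m := box (L^{n−m}•c) (ρ(n−m, R))` and the localised chains `U i w m := box (L^{i+1−m}•w) (ρ(i−m, L))`
  have h := sum_norm_linTower_le_localised L hL1 U₀ n hV α hα0 hα hα24 Y Q hQ0 hQs (box c R)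
    (fun m => box (((L : ℤ) ^ (n - m)) • c) ((L : ℤ) ^ (n - m) * (R + 4) - 4))
    (by rw [Nat.sub_self, pow_zero, one_smul, one_mul]; congr 1; ring)
    (by
      intro m hm z hz κ r t ht
      have hb := block_mem_box L hz r ht κ
      rw [smul_pow_smul, show n - (m + 1) + 1 = n - m by omega] at hb
      exact box_mono _ (by have := rad_step L hL R (n - (m + 1)); rw [show n - (m + 1) + 1 = n - m by omega] at this; exact this) hb)
    (by
      intro m hm z hz κ s
      have hb := shiftBlock_mem_box L hL1 hz κ s
      rw [smul_pow_smul, show n - (m + 1) + 1 = n - m by omega] at hb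
      exact box_mono _ (by have := rad_step L hL R (n - (m + 1)); rw [show n - (m + 1) + 1 = n - m by omega] at this; exact this) hb)
    (fun i w m => box (((L : ℤ) ^ (i + 1 - m)) • w) ((L : ℤ) ^ (i - m) * (L + 4) - 4))
    (by
      intro i hi w r s hs
      have hb := steps_mem_box_corner L ((L : ℤ) • w) r hs
      rw [show i + 1 - i = 1 by omega, pow_one, Nat.sub_self, pow_zero, one_mul]
      rwa [show ((L : ℤ) + 4 - 4) = (L : ℤ) by ring])
    (by
      intro i hi w m hm z hz κ r t ht
      have hb := block_mem_box L hz r ht κ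
      rw [smul_pow_smul, show i + 1 - (m + 1) + 1 = i + 1 - m by omega] at hb
      exact box_mono _ (by have := rad_step L hL (L : ℤ) (i - (m + 1)); rw [show i - (m + 1) + 1 = i - m by omega] at this; exact this) hb)
    (by
      intro i hi w m hm z hz κ s
      have hb := shiftBlock_mem_box L hL1 hz κ s
      rw [smul_pow_smul, show i + 1 - (m + 1) + 1 = i + 1 - m by omega] at hb
      exact box_mono _ (by have := rad_step L hL (L : ℤ) (i - (m + 1)); rw [show i - (m + 1) + 1 = i - m by omega] at this; exact this) hb)
  -- read the chains at `m = 0`: `L^{n−0} = Lⁿ`, `L^{i+1−0} • (L^{n−1−i} • v) = Lⁿ • v`, `L^{i−0} = Lⁱ`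
  have eZ : box (((L : ℤ) ^ (n - 0)) • c) ((L : ℤ) ^ (n - 0) * (R + 4) - 4) = box (((L : ℤ) ^ n) • c) ((L : ℤ) ^ n * (R + 4) - 4) := by
    rw [Nat.sub_zero]
  have eU : ∀ i ∈ Finset.range n, ∀ (v : Site d),
      box (((L : ℤ) ^ (i + 1 - 0)) • ((((L : ℤ) ^ (n - 1 - i)) • v))) ((L : ℤ) ^ (i - 0) * (L + 4) - 4)
        = box (((L : ℤ) ^ n) • v) ((L : ℤ) ^ i * (L + 4) - 4) := by
    intro i hi v
    have hi' : i < n := Finset.mem_range.mp hi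
    rw [Nat.sub_zero, Nat.sub_zero, smul_smul, ← pow_add, show i + 1 + (n - 1 - i) = n by omega]
  have e1 : ∀ i ∈ Finset.range n,
      ∑ z ∈ box c R, ∑ κ : Fin d,
          (∑ x ∈ box (((L : ℤ) ^ (i + 1 - 0)) • ((((L : ℤ) ^ (n - 1 - i)) • z))) ((L : ℤ) ^ (i - 0) * (L + 4) - 4), ∑ μ : Fin d, ‖Y x μ‖ +
            ∑ x ∈ box (((L : ℤ) ^ (i + 1 - 0)) • ((((L : ℤ) ^ (n - 1 - i)) • (z + e κ)))) ((L : ℤ) ^ (i - 0) * (L + 4) - 4), ∑ μ : Fin d, ‖Y x μ‖)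
        = ∑ z ∈ box c R, ∑ κ : Fin d,
          (∑ x ∈ box (((L : ℤ) ^ n) • z) ((L : ℤ) ^ i * (L + 4) - 4), ∑ μ : Fin d, ‖Y x μ‖ +
            ∑ x ∈ box (((L : ℤ) ^ n) • (z + e κ)) ((L : ℤ) ^ i * (L + 4) - 4), ∑ μ : Fin d, ‖Y x μ‖) :=
    fun i hi => Finset.sum_congr rfl fun z _ => Finset.sum_congr rfl fun κ _ => by rw [eU i hi z, eU i hi (z + e κ)]
  have e2 : ∑ i ∈ Finset.range n, (∏ m ∈ Finset.range i, ((L : ℝ) * ((L : ℝ) ^ d)⁻¹ + 2 * d * (210 * α m * ((2 * d + 2) * L)))) *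
          ∑ z ∈ box c R, ∑ κ : Fin d,
            (∑ x ∈ box (((L : ℤ) ^ (i + 1 - 0)) • ((((L : ℤ) ^ (n - 1 - i)) • z))) ((L : ℤ) ^ (i - 0) * (L + 4) - 4), ∑ μ : Fin d, ‖Y x μ‖ +
              ∑ x ∈ box (((L : ℤ) ^ (i + 1 - 0)) • ((((L : ℤ) ^ (n - 1 - i)) • (z + e κ)))) ((L : ℤ) ^ (i - 0) * (L + 4) - 4), ∑ μ : Fin d, ‖Y x μ‖)
      = ∑ i ∈ Finset.range n, (∏ m ∈ Finset.range i, ((L : ℝ) * ((L : ℝ) ^ d)⁻¹ + 2 * d * (210 * α m * ((2 * d + 2) * L)))) *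
          ∑ z ∈ box c R, ∑ κ : Fin d,
            (∑ x ∈ box (((L : ℤ) ^ n) • z) ((L : ℤ) ^ i * (L + 4) - 4), ∑ μ : Fin d, ‖Y x μ‖ +
              ∑ x ∈ box (((L : ℤ) ^ n) • (z + e κ)) ((L : ℤ) ^ i * (L + 4) - 4), ∑ μ : Fin d, ‖Y x μ‖) :=
    Finset.sum_congr rfl fun i hi => congrArg₂ HMul.hMul rfl (e1 i hi)
  have e3 : ∑ y ∈ box (((L : ℤ) ^ (n - 0)) • c) ((L : ℤ) ^ (n - 0) * (R + 4) - 4), ∑ ν : Fin d, ‖Y y ν‖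
      = ∑ y ∈ box (((L : ℤ) ^ n) • c) ((L : ℤ) ^ n * (R + 4) - 4), ∑ ν : Fin d, ‖Y y ν‖ := by rw [eZ]
  exact le_of_le_of_eq h (congrArg₂ HAdd.hAdd (congrArg₂ HMul.hMul rfl e3) (congrArg₂ HMul.hMul rfl e2))

end Summit.QuantumFields.YangMills.Theorems.Prop7CornerCombL1PropagationBoxes

end
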